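import Summits.NavierStokesRegularity.NavierStokesRegularity.Theorems.GaldiLiouvilleGateRecordZoomAncientStubKernelAt
import Summits.NavierStokesRegularity.NavierStokesRegularity.Theorems.GaldiLiouvilleGateRecordZoomAncientStubLocalZoomLimit
import Summits.NavierStokesRegularity.NavierStokesRegularity.Theorems.GaldiLiouvilleGateRecordZoomAncientStubZoomNondegenerate
import Summits.NavierStokesRegularity.NavierStokesRegularity.Theorems.GaldiLiouvilleGateRecordZoomAncientStubNormalise
import Summits.NavierStokesRegularity.NavierStokesRegularity.Theorems.GaldiLiouvilleGateRecordZoomAncientStubCutoffEnstrophy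
import HarnessLib

/-!
# Route `GaldiLiouvilleGate`, crux `RecordZoomAncient` (stmt-NavierStokesRegularity-0894),
  line `registered`, reshape r7 — the PERSISTENT-BUMP RUNG and `Z` from the diffuse-faint kernel

Lead `prover-line-stmt-NavierStokesRegularity-0894-c4-0`, 2026-08-17. Two theorems (namespace
`…Theorems.RecordZoomAncient.Birth`):

* `recordZoomAncientAt_of_persistentBump` — **the new rung.** For a classical solution `(u, p)` on
  `ℝ³ × [0, T)`, Leray–Hopf from `u 0`: base times `tc n ∈ (0, T)`, centres `xc n`, velocity levels `M n > 0`
  dominating `‖u‖` on `[0, tc n] × ℝ³` with `tc n (M n)² → ∞`, near-maximal velocity `‖u(tc n, xc n)‖ ≥ θ M n`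
  (`θ > 0`), and, for every `R, S > 0` eventually in `n`, local bounds on `[tc n − Sν/(M n)², tc n] ∩ [0, tc n]`
  in the ball `B(xc n, Rν/M n)` — enstrophy `≤ D ν M n`, `∫‖u‖⁶ ≤ D₆ (ν M n)³` — produce a NONTRIVIAL bounded
  ancient mild solution (`ν = 1`), smooth on `(−∞,0) × ℝ³`, with `∫|∇v(s)|² ≤ 1` and `v(s) ∈ L⁶` for all
  `s < 0` (the conclusion of the crux). Mechanism: the VELOCITY-normalised (KNSS) zooms
  `z n (s, y) = (M n)⁻¹ u(tc n + νs/(M n)², xc n + (ν/M n) y)` are bounded by `1` on their whole past, so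
  KNSS 2009 Lemma 6.1 gives a bounded ancient mild limit (`stub_localZoomLimit`, p@S2@, with `L⁶` slices by
  Fatou on balls and the zooms' inherited local bounds); it is nonzero at `(s₁(θ), 0)` by the uniform ¼-Hölder
  modulus (`stub_zoomNondegenerate`, p@S3@); every limit slice has global enstrophy `≤ 2D + cD₆^{1/3}` by the
  cutoff/Hölder lower-semicontinuity lemma (`stub_cutoffEnstrophy`, p@S5@); rescale (`stub_normalise`, p162442).
  This is the planner's why-might-fail scenario for the crux read literally (N → ∞ separated critical bumps of
  cell Reynolds number ≈ 1): it is NOT a failure mode of the crux.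
* `recordZoomAncient_of_diffuseFaintKernel` — **`Z` from the r7 kernel** (`stub_diffuseFaintKernel` of
  `Cruxes/RecordZoomAncient/Lines/birth.lean`, verbatim as a hypothesis): split on the existence of a persistent
  isolated critical bump — yes: the rung; no: the pointwise r5 composition `stub_kernelAt` (p162337) fed with the
  kernel. Supersedes `recordZoomAncient_of_noFaintBlowupKernel` (p158940, r5/r6 kernel = FCV) in the sense that
  the r7 kernel is implied by the r6 one.

Sources: G. Koch, N. Nadirashvili, G. Seregin, V. Šverák, Acta Math. 203 (2009), Lemma 6.1, Prop. 4.1, §6;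
W. S. Ożański, B. C. Pooley, LMS Lecture Notes 452 (2018), Thm. 6.37.
-/

noncomputable section

open Set MeasureTheory Filter Topology Function
open scoped ENNReal NNReal
open Literature.Analysis.FluidPDE

namespace Summit.NavierStokesRegularity.NavierStokesRegularity.Theorems.RecordZoomAncient.Birth

-- the problem-side namespace `Summit.NavierStokesRegularity.NavierStokesRegularity.…` (summit =
-- problem for this single-problem summit) duplicates `NavierStokesRegularity` by design
set_option linter.dupNamespace false

/-- **The new rung (r7): a persistent isolated critical bump gives the conclusion of the crux.** For a classical
solution `(u, p)` on `ℝ³ × [0, T)`, Leray–Hopf from `u 0`: base times `tc n ∈ (0, T)`, centres `xc n`, velocity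
levels `M n` dominating `‖u‖` on `[0, tc n] × ℝ³` with `tc n (M n)² → ∞`, near-maximal velocity `‖u(tc n, xc n)‖ ≥ θ M n`,
and local enstrophy / `L⁶` bounds in balls of `R` velocity radii over `S` viscous times (eventually in `n`, every
`R, S`) produce a NONTRIVIAL bounded ancient mild solution (`ν = 1`), smooth, with enstrophy `≤ 1` and `L⁶` slices.
Proof: velocity-normalised zooms; `stub_localZoomLimit` (limit, mildness, smoothness, `L⁶`, inherited local bounds);
`stub_zoomNondegenerate` (the limit is nonzero at `(s₁, 0)`); `stub_cutoffEnstrophy` (finite global enstrophy of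
every limit slice, uniformly in `s`); `stub_normalise`. -/
theorem recordZoomAncientAt_of_persistentBump :
    ∀ (ν T : ℝ), 0 < ν → 0 < T → ∀ (u : ℝ → EuclideanSpace ℝ (Fin 3) → EuclideanSpace ℝ (Fin 3)) (p : ℝ →
      EuclideanSpace ℝ (Fin 3) → ℝ), IsClassicalNSSolutionOn (Set.Ico 0 T) ν 0 u p → IsLerayHopfOn T ν 0 (u 0)
      u → ∀ (tc : ℕ → ℝ) (xc : ℕ → EuclideanSpace ℝ (Fin 3)) (M : ℕ → ℝ) (θ D D₆ : ℝ), (∀ n, 0 < tc n ∧ tc n <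
      T) → (∀ n, 0 < M n) → (∀ n, ∀ t ∈ Set.Icc 0 (tc n), ∀ x, ‖u t x‖ ≤ M n) → Filter.Tendsto (fun n => tc n *
      M n ^ 2) Filter.atTop Filter.atTop → 0 < θ → (∀ n, θ * M n ≤ ‖u (tc n) (xc n)‖) → (∀ R S : ℝ, 0 < R → 0 <
      S → ∀ᶠ n in Filter.atTop, ∀ t ∈ Set.Icc 0 (tc n), tc n - S * (ν / M n ^ 2) ≤ t → (∫⁻ y in Metric.ball (xc
      n) (R * (ν / M n)), ENNReal.ofReal (frobeniusNormSq (fderiv ℝ (u t) y))) ≤ ENNReal.ofReal (D * (ν * M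
      n))) → (∀ R S : ℝ, 0 < R → 0 < S → ∀ᶠ n in Filter.atTop, ∀ t ∈ Set.Icc 0 (tc n), tc n - S * (ν / M n ^ 2)
      ≤ t → (∫⁻ y in Metric.ball (xc n) (R * (ν / M n)), ‖u t y‖ₑ ^ (6 : ℕ)) ≤ ENNReal.ofReal (D₆ * (ν * M n) ^
      3)) → ∃ v : ℝ → EuclideanSpace ℝ (Fin 3) → EuclideanSpace ℝ (Fin 3), IsBoundedAncientMildSolution 1 v ∧
      ContDiffOn ℝ (⊤ : ℕ∞) (Function.uncurry v) (Set.Iio 0 ×ˢ Set.univ) ∧ (∀ s < 0, ∫⁻ y, ENNReal.ofReal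
      (frobeniusNormSq (fderiv ℝ (v s) y)) ≤ 1) ∧ (∀ s < 0, MeasureTheory.MemLp (v s) 6 MeasureTheory.volume) ∧
      ¬ (∀ s < 0, ∀ y, v s y = 0) := by
  intro ν T hν hT u p hcl hLH tc xc M θ D D₆ htc hM hdomV hpast hθ hvel hE h6
  -- ### WLOG `D, D₆ ≥ 0`
  set D' : ℝ := max D 0 with hD'def
  set D₆' : ℝ := max D₆ 0 with hD₆'def
  have hD'0 : 0 ≤ D' := le_max_right _ _
  have hD₆'0 : 0 ≤ D₆' := le_max_right _ _
  have hE' : ∀ R S : ℝ, 0 < R → 0 < S → ∀ᶠ n in atTop, ∀ t ∈ Set.Icc 0 (tc n), tc n - S * (ν / M n ^ 2) ≤ t →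
      (∫⁻ y in Metric.ball (xc n) (R * (ν / M n)), ENNReal.ofReal (frobeniusNormSq (fderiv ℝ (u t) y))) ≤
        ENNReal.ofReal (D' * (ν * M n)) := by
    intro R S hR hS
    filter_upwards [hE R S hR hS] with n hn t ht hst
    refine (hn t ht hst).trans (ENNReal.ofReal_le_ofReal ?_)
    exact mul_le_mul_of_nonneg_right (le_max_left _ _) (mul_pos hν (hM n)).le
  have h6' : ∀ R S : ℝ, 0 < R → 0 < S → ∀ᶠ n in atTop, ∀ t ∈ Set.Icc 0 (tc n), tc n - S * (ν / M n ^ 2) ≤ t →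
      (∫⁻ y in Metric.ball (xc n) (R * (ν / M n)), ‖u t y‖ₑ ^ (6 : ℕ)) ≤
        ENNReal.ofReal (D₆' * (ν * M n) ^ 3) := by
    intro R S hR hS
    filter_upwards [h6 R S hR hS] with n hn t ht hst
    refine (hn t ht hst).trans (ENNReal.ofReal_le_ofReal ?_)
    exact mul_le_mul_of_nonneg_right (le_max_left _ _) (pow_pos (mul_pos hν (hM n)) 3).le
  -- ### the zooms and their limit
  set z : ℕ → ℝ → EuclideanSpace ℝ (Fin 3) → EuclideanSpace ℝ (Fin 3) :=
    fun n s y => (M n)⁻¹ • u (tc n + ν / M n ^ 2 * s) (xc n + (ν / M n) • y) with hz_def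
  have hz : ∀ n s y, z n s y = (M n)⁻¹ • u (tc n + ν / M n ^ 2 * s) (xc n + (ν / M n) • y) :=
    fun n s y => rfl
  obtain ⟨φ, v, hφ, hconv, hmild, hsm, hL6, hZE, hZ6⟩ :=
    stub_localZoomLimit ν T hν hT u p hcl hLH tc xc M D' D₆' htc hM hdomV hpast hE' h6' z hz
  -- ### non-degeneracy of the limit at `(s₁, 0)`
  obtain ⟨s₁, hs₁, hs₁1, hnd⟩ := stub_zoomNondegenerate θ hθ
  have hβpos : ∀ n, 0 < ν / M n ^ 2 := fun n => div_pos hν (pow_pos (hM n) 2)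
  -- eventually `3 ν/(M n)² ≤ tc n`
  have hev3 : ∀ᶠ n in atTop, 3 * (ν / M n ^ 2) ≤ tc n := by
    have h := hpast.eventually (eventually_ge_atTop (3 * ν))
    filter_upwards [h] with n hn
    rw [← div_le_iff₀ (pow_pos (hM n) 2)] at hn
    simpa [mul_div_assoc] using hn
  have hlow : ∀ᶠ k in atTop, θ / 2 ≤ ‖z (φ k) s₁ 0‖ := by
    have h := hφ.tendsto_atTop.eventually hev3
    filter_upwards [h] with k hk
    have hkey := hnd ν T hν hT u p hcl hLH (tc (φ k)) (xc (φ k)) (M (φ k)) (htc _).1 (htc _).2 (hM _) hk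
      (hdomV _) (hvel _)
    rw [hz, smul_zero, add_zero, norm_smul, norm_inv, Real.norm_of_nonneg (hM _).le,
      ← div_eq_inv_mul, le_div_iff₀ (hM _)]
    linarith
  have hv0 : v s₁ 0 ≠ 0 := by
    intro h0
    have hlim : Tendsto (fun k => ‖z (φ k) s₁ 0‖) atTop (𝓝 0) := by
      have h := (hconv _ hs₁ 0).norm
      rwa [h0, norm_zero] at h
    have hle : θ / 2 ≤ 0 := ge_of_tendsto hlim hlow
    linarith
  -- ### finite global enstrophy of the limit slices, uniformly in `s`
  obtain ⟨c, hc, hcut⟩ := stub_cutoffEnstrophy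
  have hens : ∀ s < 0, ∫⁻ y, ENNReal.ofReal (frobeniusNormSq (fderiv ℝ (v s) y)) ≤
      ENNReal.ofReal (2 * D' + c * D₆' ^ (1 / 3 : ℝ)) := by
    intro s hs
    -- a tail of the subsequence along which the slice `s` lies in the dominated past of every zoom
    have hevA : ∀ᶠ k in atTop, -s * (ν / M (φ k) ^ 2) < tc (φ k) := by
      have h1 : Tendsto (fun k => tc (φ k) * M (φ k) ^ 2) atTop atTop := hpast.comp hφ.tendsto_atTop
      filter_upwards [h1.eventually (eventually_gt_atTop (-s * ν))] with k hk
      have h2 : -s * (ν / M (φ k) ^ 2) = (-s * ν) / M (φ k) ^ 2 := by ring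
      rw [h2, div_lt_iff₀ (pow_pos (hM _) 2)]
      exact hk
    obtain ⟨N, hN⟩ := eventually_atTop.1 hevA
    -- the tail fields
    set f : ℕ → EuclideanSpace ℝ (Fin 3) → EuclideanSpace ℝ (Fin 3) := fun k => z (φ (k + N)) s with hf_def
    have hmem : ∀ k, tc (φ (k + N)) + ν / M (φ (k + N)) ^ 2 * s ∈ Set.Ioc 0 (tc (φ (k + N))) := by
      intro k
      have h1 := hN (k + N) (Nat.le_add_left N k)
      have h2 : ν / M (φ (k + N)) ^ 2 * s ≤ 0 :=
        mul_nonpos_of_nonneg_of_nonpos (hβpos _).le hs.le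
      constructor <;> nlinarith [hβpos (φ (k + N))]
    have hf1 : ∀ k, ContDiff ℝ 1 (f k) := by
      intro k
      have ht : tc (φ (k + N)) + ν / M (φ (k + N)) ^ 2 * s ∈ Set.Ico 0 T :=
        ⟨(hmem k).1.le, (hmem k).2.trans_lt (htc _).2⟩
      have hu : ContDiff ℝ 1 (u (tc (φ (k + N)) + ν / M (φ (k + N)) ^ 2 * s)) :=
        (hcl.contDiff_velocity ht).of_le (by norm_cast)
      have hg : ContDiff ℝ 1 (fun y : EuclideanSpace ℝ (Fin 3) => xc (φ (k + N)) + (ν / M (φ (k + N))) • y) :=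
        contDiff_const.add (contDiff_id.const_smul _)
      exact (hu.comp hg).const_smul ((M (φ (k + N)))⁻¹)
    have hfl : ContDiff ℝ 1 (v s) := by
      have hsm' : IsSmoothSpaceTimeOn (Set.Iio 0) v := hsm
      exact (hsm'.contDiff_slice hs).of_le (by norm_cast)
    have hbd : ∀ k x, ‖f k x‖ ≤ 1 := by
      intro k x
      simp only [hf_def, hz_def, norm_smul, norm_inv, Real.norm_of_nonneg (hM _).le]
      rw [inv_mul_le_iff₀ (hM _), mul_one]
      exact hdomV _ _ ⟨(hmem k).1.le, (hmem k).2⟩ _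
    have hconvf : ∀ x, Tendsto (fun k => f k x) atTop (𝓝 (v s x)) := fun x =>
      (hconv s hs x).comp (tendsto_add_atTop_nat N)
    have hEf : ∀ R : ℝ, 0 < R → ∀ᶠ k in atTop,
        (∫⁻ y in Metric.ball 0 R, ENNReal.ofReal (frobeniusNormSq (fderiv ℝ (f k) y))) ≤ ENNReal.ofReal D' := by
      intro R hR
      have h := (hφ.tendsto_atTop.comp (tendsto_add_atTop_nat N)).eventually (hZE R (-s) hR (neg_pos.2 hs))
      filter_upwards [h] with k hk
      exact hk s ⟨le_rfl.trans (neg_neg s).le, hs.le⟩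
    have h6f : ∀ R : ℝ, 0 < R → ∀ᶠ k in atTop,
        (∫⁻ y in Metric.ball 0 R, ‖f k y‖ₑ ^ (6 : ℕ)) ≤ ENNReal.ofReal D₆' := by
      intro R hR
      have h := (hφ.tendsto_atTop.comp (tendsto_add_atTop_nat N)).eventually (hZ6 R (-s) hR (neg_pos.2 hs))
      filter_upwards [h] with k hk
      exact hk s ⟨le_rfl.trans (neg_neg s).le, hs.le⟩
    exact hcut f (v s) D' D₆' hD'0 hD₆'0 hf1 hfl hbd hconvf hEf h6f
  -- ### normalisation
  exact stub_normalise v (2 * D' + c * D₆' ^ (1 / 3 : ℝ)) hmild hsm hens hL6 ⟨s₁, hs₁, 0, hv0⟩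

/-- **`Z` from the r7 kernel `stub_diffuseFaintKernel`, verbatim as a hypothesis** (the closed twin of the
skeleton `Cruxes/RecordZoomAncient/Lines/birth.lean`, reshape r7). The hypothesis says that no classical
Leray–Hopf solution from a rapidly decaying datum blows up at `T` in the regime (1) Type-II enstrophy ∧
(2) eventually slow doubling at every scale ∧ (3) vanishing at the critical scale ∧ (4) faint ∧ (5) NO
PERSISTENT ISOLATED CRITICAL BUMP. Composition: `by_cases` on the existence of a persistent isolated critical
bump — yes: `recordZoomAncientAt_of_persistentBump`; no: `stub_kernelAt` fed with the kernel. -/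
theorem recordZoomAncient_of_diffuseFaintKernel :
    (∀ (ν T : ℝ), 0 < ν → 0 < T → ∀ (u : ℝ → EuclideanSpace ℝ (Fin 3) → EuclideanSpace ℝ (Fin 3)) (p : ℝ →
      EuclideanSpace ℝ (Fin 3) → ℝ), IsClassicalNSSolutionOn (Set.Ico 0 T) ν 0 u p → IsLerayHopfOn T ν 0 (u 0)
      u → HasRapidSpatialDecay (u 0) → ¬ HasSmoothExtensionPast ν 0 u T → (∀ C : ℝ, 0 < C → ∃ t' ∈ Set.Ico 0 T,
      ∀ t ∈ Set.Ico t' T, ∃ s ∈ Set.Icc 0 t, ENNReal.ofReal (C * (ν * Real.sqrt ν) / Real.sqrt (T - t)) < ∫⁻ x,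
      ENNReal.ofReal (frobeniusNormSq (fderiv ℝ (u s) x))) → (∀ K : ℝ, 0 < K → ∃ t' ∈ Set.Ico 0 T, ∀ t₁ ∈
      Set.Ico t' T, ∀ t₂ ∈ Set.Ioo t₁ T, ∀ L : ℝ, 0 < L → (∀ s ∈ Set.Icc 0 t₂, (∫⁻ x, ENNReal.ofReal
      (frobeniusNormSq (fderiv ℝ (u s) x))) ≤ ENNReal.ofReal (2 * L)) → (∫⁻ x, ENNReal.ofReal (frobeniusNormSq
      (fderiv ℝ (u t₁) x))) ≤ ENNReal.ofReal L → ENNReal.ofReal (2 * L) ≤ (∫⁻ x, ENNReal.ofReal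
      (frobeniusNormSq (fderiv ℝ (u t₂) x))) → K * ν ^ 3 / L ^ 2 ≤ t₂ - t₁) → (∀ R ε : ℝ, 0 < R → 0 < ε → ∃ t'
      ∈ Set.Ico 0 T, ∀ t ∈ Set.Ico t' T, ∀ x : EuclideanSpace ℝ (Fin 3), ∀ L : ℝ, 0 < L → (∀ s ∈ Set.Icc 0 t,
      (∫⁻ x, ENNReal.ofReal (frobeniusNormSq (fderiv ℝ (u s) x))) ≤ ENNReal.ofReal L) → 3 * ν ^ 3 / L ^ 2 ≤ t →
      (∫⁻ y in Metric.ball x (R * ν ^ 2 / L), ENNReal.ofReal (frobeniusNormSq (fderiv ℝ (u t) y))) <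
      ENNReal.ofReal (ε * L)) → (∀ θ : ℝ, 0 < θ → ∃ t' ∈ Set.Ico 0 T, ∀ t ∈ Set.Ico t' T, ∀ x : EuclideanSpace
      ℝ (Fin 3), ∀ L : ℝ, 0 < L → (∀ s ∈ Set.Icc 0 t, (∫⁻ x, ENNReal.ofReal (frobeniusNormSq (fderiv ℝ (u s)
      x))) ≤ ENNReal.ofReal L) → ‖u t x‖ < θ * L / ν) → (∀ (tc : ℕ → ℝ) (xc : ℕ → EuclideanSpace ℝ (Fin 3)) (M
      : ℕ → ℝ) (θ D D₆ : ℝ), (∀ n, 0 < tc n ∧ tc n < T) → (∀ n, 0 < M n) → (∀ n, ∀ t ∈ Set.Icc 0 (tc n), ∀ x,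
      ‖u t x‖ ≤ M n) → Filter.Tendsto (fun n => tc n * M n ^ 2) Filter.atTop Filter.atTop → 0 < θ → (∀ n, θ * M
      n ≤ ‖u (tc n) (xc n)‖) → (∀ R S : ℝ, 0 < R → 0 < S → ∀ᶠ n in Filter.atTop, ∀ t ∈ Set.Icc 0 (tc n), tc n -
      S * (ν / M n ^ 2) ≤ t → (∫⁻ y in Metric.ball (xc n) (R * (ν / M n)), ENNReal.ofReal (frobeniusNormSq
      (fderiv ℝ (u t) y))) ≤ ENNReal.ofReal (D * (ν * M n))) → (∀ R S : ℝ, 0 < R → 0 < S → ∀ᶠ n in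
      Filter.atTop, ∀ t ∈ Set.Icc 0 (tc n), tc n - S * (ν / M n ^ 2) ≤ t → (∫⁻ y in Metric.ball (xc n) (R * (ν
      / M n)), ‖u t y‖ₑ ^ (6 : ℕ)) ≤ ENNReal.ofReal (D₆ * (ν * M n) ^ 3)) → False) → False) →
      Summit.NavierStokesRegularity.NavierStokesRegularity.Theses.GaldiLiouvilleGate.RecordZoomAncient := by
  intro hKernel ν T hν hT u p hcl hLH hdec hnext
  by_cases hb : ∃ (tc : ℕ → ℝ) (xc : ℕ → EuclideanSpace ℝ (Fin 3)) (M : ℕ → ℝ) (θ D D₆ : ℝ),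
      (∀ n, 0 < tc n ∧ tc n < T) ∧ (∀ n, 0 < M n) ∧
      (∀ n, ∀ t ∈ Set.Icc 0 (tc n), ∀ x, ‖u t x‖ ≤ M n) ∧
      Tendsto (fun n => tc n * M n ^ 2) atTop atTop ∧
      0 < θ ∧ (∀ n, θ * M n ≤ ‖u (tc n) (xc n)‖) ∧
      (∀ R S : ℝ, 0 < R → 0 < S → ∀ᶠ n in atTop, ∀ t ∈ Set.Icc 0 (tc n), tc n - S * (ν / M n ^ 2) ≤ t →
        (∫⁻ y in Metric.ball (xc n) (R * (ν / M n)), ENNReal.ofReal (frobeniusNormSq (fderiv ℝ (u t) y))) ≤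
          ENNReal.ofReal (D * (ν * M n))) ∧
      (∀ R S : ℝ, 0 < R → 0 < S → ∀ᶠ n in atTop, ∀ t ∈ Set.Icc 0 (tc n), tc n - S * (ν / M n ^ 2) ≤ t →
        (∫⁻ y in Metric.ball (xc n) (R * (ν / M n)), ‖u t y‖ₑ ^ (6 : ℕ)) ≤
          ENNReal.ofReal (D₆ * (ν * M n) ^ 3))
  · obtain ⟨tc, xc, M, θ, D, D₆, htc, hM, hdomV, hpast, hθ, hvel, hE, h6⟩ := hb
    exact recordZoomAncientAt_of_persistentBump ν T hν hT u p hcl hLH tc xc M θ D D₆ htc hM hdomV hpast hθ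
      hvel hE h6
  · exact stub_kernelAt ν T hν hT u p hcl hLH hdec hnext fun h1 h2 h3 h4 =>
      hKernel ν T hν hT u p hcl hLH hdec hnext h1 h2 h3 h4
        fun tc xc M θ D D₆ htc hM hdomV hpast hθ hvel hE h6 =>
          hb ⟨tc, xc, M, θ, D, D₆, htc, hM, hdomV, hpast, hθ, hvel, hE, h6⟩

end Summit.NavierStokesRegularity.NavierStokesRegularity.Theorems.RecordZoomAncient.Birth

end
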